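import Literature.AlgebraicGeometry.FundamentalGroup.RiemannExistenceMilnorDescent
import Literature.AlgebraicGeometry.FundamentalGroup.RiemannExistenceNilpotentReduction
import Literature.AlgebraicGeometry.FundamentalGroup.RiemannExistenceZariskiLocal
import Literature.AlgebraicGeometry.FundamentalGroup.FiniteEtaleNilpotentLift
import Literature.AlgebraicGeometry.Motives.AlgPointsNilpotentThickening
import Literature.AlgebraicGeometry.Motives.CechCoverDescent
import Literature.AlgebraicGeometry.Resolution.NormalizationOfVarietiesProofs
import Literature.RingTheory.KTheory.MilnorSquares
import Mathlib.RingTheory.Jacobson.Ring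
import Mathlib.RingTheory.Ideal.GoingUp
import Mathlib.FieldTheory.IsAlgClosed.Basic
import HarnessLib

/-!
# Riemann's existence theorem: reduction to a normal affine base

Topic `Literature/AlgebraicGeometry/FundamentalGroup`. Part 2 a) of the proof of SGA 1 XII
Thm. 5.1 («on peut donc supposer `X` normal») for the named fact
`riemannExistence_finiteCovering` (every finite-fibred covering space of `S(ℂ)`, `S`
quasi-projective over `ℂ`, is `S'(ℂ)` for a finite étale `S' → S`), carried out ALGEBRAICALLY:
instead of descent of finite étale covers along the normalisation (SGA 1 IX 4.7, which needs
henselian pairs and fpqc descent), the covering is descended along CONDUCTOR SQUARES and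
TWO-COMPONENT SQUARES, which are Milnor squares (`ringRiemannExistence_of_milnorSquare`,
`RiemannExistenceMilnorDescent.lean`), by Noetherian induction.

* `ringRiemannExistence_of_surjective_of_isNilpotent` — ring form of the nilpotent-thickening
  step (`A → A₀` onto with nilpotent kernel; SGA 1 I 8.3 via
  `Literature.RingTheory.Etale.exists_finite_etale_lift`);
* `ringRiemannExistence_of_subsingleton` — the zero ring;
* `exists_algHom_comp_eq_of_isIntegral` (complex points extend along injective integral
  extensions: lying over + Zariski's lemma), `algHom_eq_or_exists_of_conductor` (off the conductor
  a finite birational extension does not separate complex points), `exists_algHom_quotient_map`,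
  `exists_algHom_quotient_or` — the point-set hypotheses of the descent step;
* `ringRiemannExistence_of_inf_eq_bot` — `A = A/J₁ ×_{A/(J₁+J₂)} A/J₂` for `J₁ ∩ J₂ = 0`;
* `finite_integralClosure_fractionRing`, `conductorIdeal_integralClosure_ne_bot`,
  `ringRiemannExistence_of_isDomain` — the conductor square `A = Ã ×_{Ã/𝔠} A/𝔠` of the (finite,
  E. Noether / `NoetherFiniteIntegralClosure_holds`) normalisation of a domain `A`;
* `isRadical_annihilator`, `ringRiemannExistence_doubleQuot`,
  `ringRiemannExistence_quotient_of_isRadical` — Noetherian induction on radical ideals `I ⊆ R`: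
  `R/I` zero, or a domain (conductor square; the factor `(R/I)/𝔠` comes from `√𝔠 ⊋ 0` by
  induction and the thickening `(R/I)/𝔠 → (R/I)/√𝔠`), or has `a b = 0` with `a, b ≠ 0` and is
  the square of `Ann(b) ∋ a` and `Ann(Ann(b)) ∋ b` (non-zero radical ideals meeting in `0`);
  `ringRiemannExistence_of_isReduced`;
* **`riemannExistence_finiteCovering_of_normal`** — the named fact follows from Riemann
  existence in ring form for NORMAL domains of finite type over `ℂ` (through
  `riemannExistence_finiteCovering_of_reduced`, `ZariskiLocal.riemannExistence_of_affineOpens`,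
  `riemannExistence_of_iso`, `riemannExistence_specOver_of_ring`);
  `ringRiemannExistence_of_specOver` (scheme form ⇒ ring form for `Spec R`) and
  **`riemannExistence_finiteCovering_of_normal_affine`** — the same with the normal case in
  scheme form (`S` affine of finite type, `Γ(S, 𝒪_S)` an integrally closed domain). What remains
  of SGA 1 XII 5.1 is its analytic core for normal `X` (XII 5.3, resolution, XII 5.4 and GAGA
  XII 4.6).

Riemann existence "in ring form" for `R` is written out in full in each statement: every
finite-fibred covering `q : T → (Spec R)(ℂ)` admits a finite étale `R`-algebra `B` and a
homeomorphism `(Spec B)(ℂ) ≃ₜ T` over `(Spec R)(ℂ)`. Everything is proved; no named facts, no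
definitions.

## References

* [SGA1] A. Grothendieck, M. Raynaud, *Revêtements étales et groupe fondamental (SGA 1)*,
  LNM 224 / arXiv:math/0206203, Exp. XII Thm. 5.1, proof, part 2 a), p. 333 of the SMF edition
  (p0184 of the materialised text); Exp. I Thm. 8.3; Exp. IX 4.7 (replaced here).
* [Milnor1972] J. Milnor, *Introduction to algebraic K-theory*, §2 (Milnor squares and patching).
* [Liu2002] Q. Liu, *Algebraic Geometry and Arithmetic Curves*, Prop. 4.1.27 / Cor. 4.1.30
  (finiteness of normalisation), through the tree's `NoetherFiniteIntegralClosure_holds`.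

#harness_tags algebraic_geometry.sga1, hodge.stub_C1
-/

noncomputable section

open CategoryTheory CategoryTheory.Limits AlgebraicGeometry TensorProduct
open _root_.Topology

namespace Literature.AlgebraicGeometry.FundamentalGroup

open Literature.AlgebraicGeometry.Motives Literature.AlgebraicGeometry.Motives.AlgPoints
open Literature.RingTheory.KTheory Literature.RingTheory.Etale

/-! ### Riemann existence (ring form) along a nilpotent thickening -/

section Thickening

variable {A A₀ : Type} [CommRing A] [Algebra ℂ A] [CommRing A₀] [Algebra ℂ A₀]

/-- **Ring form of `riemannExistence_finiteCovering_of_thickening`**: for a surjection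
`φ : A → A₀` of `ℂ`-algebras with nilpotent kernel, Riemann existence in ring form for `A₀`
implies it for `A`: `(Spec A₀)(ℂ) ≅ (Spec A)(ℂ)`, and a finite étale `A₀`-algebra realising the
covering lifts to a finite étale `A`-algebra with the same complex points (SGA 1 I 8.3,
`Literature.RingTheory.Etale.exists_finite_etale_lift`).
[cite: SGA1, Exp. XII Thm. 5.1 (proof, part 2 a)), with Exp. I Thm. 8.3] -/
theorem ringRiemannExistence_of_surjective_of_isNilpotent (φ : A →ₐ[ℂ] A₀)
    (hφ : Function.Surjective φ) (hker : IsNilpotent (RingHom.ker φ.toRingHom))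
    (h₀ : ∀ (T : Type) [TopologicalSpace T] (q : T → Motives.ComplexPoints (specOver ℂ A₀)),
      IsCoveringMap q → (∀ x, (q ⁻¹' {x}).Finite) →
      ∃ (B : Type) (_ : CommRing B) (_ : Algebra A₀ B) (_ : Algebra ℂ B) (_ : IsScalarTower ℂ A₀ B)
        (_ : Module.Finite A₀ B) (_ : Algebra.Etale A₀ B)
        (Φ : Motives.ComplexPoints (specOver ℂ B) ≃ₜ T),
        ∀ z, q (Φ z) = AlgPoints.map (specOverOfAlgHom (IsScalarTower.toAlgHom ℂ A₀ B)) z) :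
    ∀ (T : Type) [TopologicalSpace T] (q : T → Motives.ComplexPoints (specOver ℂ A)),
      IsCoveringMap q → (∀ x, (q ⁻¹' {x}).Finite) →
      ∃ (B : Type) (_ : CommRing B) (_ : Algebra A B) (_ : Algebra ℂ B) (_ : IsScalarTower ℂ A B)
        (_ : Module.Finite A B) (_ : Algebra.Etale A B)
        (Φ : Motives.ComplexPoints (specOver ℂ B) ≃ₜ T),
        ∀ z, q (Φ z) = AlgPoints.map (specOverOfAlgHom (IsScalarTower.toAlgHom ℂ A B)) z := by
  intro T _ q hq hfin
  -- `(Spec A₀)(ℂ) ≅ (Spec A)(ℂ)`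
  let i : specOver ℂ A₀ ⟶ specOver ℂ A := specOverOfAlgHom φ
  haveI : IsClosedImmersion i.left := by
    change IsClosedImmersion (Spec.map (CommRingCat.ofHom φ.toRingHom))
    exact IsClosedImmersion.spec_of_surjective _ hφ
  haveI : Surjective i.left := by
    change Surjective (Spec.map (CommRingCat.ofHom φ.toRingHom))
    refine NilpotentLift.surjective_specMap _ hφ fun x hx ↦ ?_
    obtain ⟨n, hn⟩ := hker
    have hx' : x ∈ RingHom.ker φ.toRingHom := hx
    refine ⟨n, ?_⟩
    have : x ^ n ∈ RingHom.ker φ.toRingHom ^ n := Ideal.pow_mem_pow hx' n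
    rwa [hn, Ideal.zero_eq_bot, Ideal.mem_bot] at this
  let E : Motives.ComplexPoints (specOver ℂ A₀) ≃ₜ Motives.ComplexPoints (specOver ℂ A) :=
    (isHomeomorph_map_of_isClosedImmersion_of_surjective (L := ℂ) i).homeomorph
  have hE : ∀ x, E x = AlgPoints.map i x := fun _ ↦ rfl
  let q₀ : T → Motives.ComplexPoints (specOver ℂ A₀) := E.symm ∘ q
  have hq₀ : IsCoveringMap q₀ := hq.homeomorph_comp E.symm
  have hfin₀ : ∀ x, (q₀ ⁻¹' {x}).Finite := fun x ↦ by
    have : q₀ ⁻¹' {x} = q ⁻¹' {E x} := by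
      ext t
      simp only [q₀, Set.mem_preimage, Function.comp_apply, Set.mem_singleton_iff]
      rw [Homeomorph.symm_apply_eq]
    rw [this]
    exact hfin _
  obtain ⟨B₀, _, _, _, _, _, _, Φ₀, hΦ₀⟩ := h₀ T q₀ hq₀ hfin₀
  -- lift `B₀` along the thickening
  letI algAB₀ : Algebra A B₀ := ((algebraMap A₀ B₀).comp φ.toRingHom).toAlgebra
  obtain ⟨B, _, _, hBet, hBfin, ψ, hψ, hkerψ⟩ :=
    Literature.RingTheory.Etale.exists_finite_etale_lift φ.toRingHom hφ hker B₀ (fun _ ↦ rfl)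
  haveI := hBet
  haveI := hBfin
  letI algCB : Algebra ℂ B := ((algebraMap A B).comp (algebraMap ℂ A)).toAlgebra
  haveI : IsScalarTower ℂ A B := IsScalarTower.of_algebraMap_eq fun _ ↦ rfl
  haveI : IsScalarTower ℂ A B₀ := IsScalarTower.of_algebraMap_eq fun c ↦ by
    change algebraMap ℂ B₀ c = algebraMap A₀ B₀ (φ (algebraMap ℂ A c))
    rw [AlgHom.commutes, ← IsScalarTower.algebraMap_apply]
  -- `(Spec B₀)(ℂ) ≅ (Spec B)(ℂ)`
  let j : specOver ℂ B₀ ⟶ specOver ℂ B := specOverOfAlgHom (ψ.restrictScalars ℂ)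
  haveI : IsClosedImmersion j.left := by
    change IsClosedImmersion (Spec.map (CommRingCat.ofHom (ψ.restrictScalars ℂ).toRingHom))
    exact IsClosedImmersion.spec_of_surjective _ hψ
  haveI : Surjective j.left := by
    change Surjective (Spec.map (CommRingCat.ofHom (ψ.restrictScalars ℂ).toRingHom))
    refine NilpotentLift.surjective_specMap _ hψ fun x hx ↦ ?_
    obtain ⟨n, hn⟩ := hker
    have hx' : x ∈ Ideal.map (algebraMap A B) (RingHom.ker φ.toRingHom) := by
      rw [← hkerψ]
      exact hx
    refine ⟨n, ?_⟩
    have : x ^ n ∈ Ideal.map (algebraMap A B) (RingHom.ker φ.toRingHom) ^ n := Ideal.pow_mem_pow hx' n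
    rwa [← Ideal.map_pow, hn, Ideal.zero_eq_bot, Ideal.map_bot, Ideal.mem_bot] at this
  let EB : Motives.ComplexPoints (specOver ℂ B₀) ≃ₜ Motives.ComplexPoints (specOver ℂ B) :=
    (isHomeomorph_map_of_isClosedImmersion_of_surjective (L := ℂ) j).homeomorph
  have hEB : ∀ x, EB x = AlgPoints.map j x := fun _ ↦ rfl
  refine ⟨B, inferInstance, inferInstance, inferInstance, inferInstance, inferInstance,
    inferInstance, EB.symm.trans Φ₀, fun z ↦ ?_⟩
  obtain ⟨z₀, rfl⟩ := EB.surjective z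
  rw [Homeomorph.trans_apply, Homeomorph.symm_apply_apply]
  have h1 : q (Φ₀ z₀) = E (q₀ (Φ₀ z₀)) := by
    simp only [q₀, Function.comp_apply, Homeomorph.apply_symm_apply]
  rw [h1, hΦ₀, hE, hEB, ← AlgPoints.map_comp_apply, ← AlgPoints.map_comp_apply]
  congr 1
  change specOverOfAlgHom _ ≫ specOverOfAlgHom φ =
    specOverOfAlgHom _ ≫ specOverOfAlgHom (IsScalarTower.toAlgHom ℂ A B)
  rw [← specOverOfAlgHom_comp, ← specOverOfAlgHom_comp]
  congr 1
  ext a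
  change algebraMap A₀ B₀ (φ a) = ψ (algebraMap A B a)
  rw [ψ.commutes]
  rfl

end Thickening

/-! ### The zero ring -/

section Zero

variable (A : Type) [CommRing A] [Algebra ℂ A]

/-- Riemann existence in ring form for the zero ring (no complex points). [folklore] -/
theorem ringRiemannExistence_of_subsingleton [Subsingleton A] :
    ∀ (T : Type) [TopologicalSpace T] (q : T → Motives.ComplexPoints (specOver ℂ A)),
      IsCoveringMap q → (∀ x, (q ⁻¹' {x}).Finite) →
      ∃ (B : Type) (_ : CommRing B) (_ : Algebra A B) (_ : Algebra ℂ B) (_ : IsScalarTower ℂ A B)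
        (_ : Module.Finite A B) (_ : Algebra.Etale A B)
        (Φ : Motives.ComplexPoints (specOver ℂ B) ≃ₜ T),
        ∀ z, q (Φ z) = AlgPoints.map (specOverOfAlgHom (IsScalarTower.toAlgHom ℂ A B)) z := by
  intro T _ q _ _
  haveI : IsEmpty (Motives.ComplexPoints (specOver ℂ A)) :=
    ⟨fun P ↦ @IsEmpty.false (PrimeSpectrum A) inferInstance P.pt⟩
  haveI : IsEmpty T := ⟨fun t ↦ IsEmpty.false (q t)⟩
  refine ⟨A, inferInstance, inferInstance, inferInstance, inferInstance, inferInstance,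
    inferInstance, ⟨Equiv.equivOfIsEmpty _ _, ⟨fun s _ ↦ ?_⟩, ⟨fun s _ ↦ ?_⟩⟩,
    fun z ↦ (IsEmpty.false z).elim⟩
  · convert isOpen_empty
    exact Set.eq_empty_of_isEmpty _
  · convert isOpen_empty
    exact Set.eq_empty_of_isEmpty _

end Zero

/-! ### The point-set hypotheses of `ringRiemannExistence_of_milnorSquare` -/

section Points

variable {A A₁ : Type} [CommRing A] [Algebra ℂ A] [CommRing A₁] [Algebra ℂ A₁] [Algebra A A₁]
  [IsScalarTower ℂ A A₁]

/-- **Complex points extend along injective integral extensions** of finite type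
`ℂ`-algebras (lying over + Nullstellensatz): for `A ⊆ A₁` integral and `χ : A → ℂ` there is
`χ₁ : A₁ → ℂ` extending it. [folklore] -/
theorem exists_algHom_comp_eq_of_isIntegral [Algebra.IsIntegral A A₁] [Algebra.FiniteType ℂ A₁]
    (hinj : Function.Injective (algebraMap A A₁)) (χ : A →ₐ[ℂ] ℂ) :
    ∃ χ₁ : A₁ →ₐ[ℂ] ℂ, χ₁.comp (IsScalarTower.toAlgHom ℂ A A₁) = χ := by
  have hχs : Function.Surjective χ.toRingHom := fun c ↦ ⟨algebraMap ℂ A c, χ.commutes c⟩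
  haveI : (RingHom.ker χ.toRingHom).IsMaximal := RingHom.ker_isMaximal_of_surjective _ hχs
  obtain ⟨Q, hQ, hQc⟩ := Ideal.exists_ideal_over_maximal_of_isIntegral (S := A₁)
    (RingHom.ker χ.toRingHom) (by
      rw [(RingHom.injective_iff_ker_eq_bot _).mp hinj]
      exact bot_le)
  letI := Ideal.Quotient.field Q
  haveI : Module.Finite ℂ (A₁ ⧸ Q) := finite_of_finite_type_of_isJacobsonRing ℂ (A₁ ⧸ Q)
  have hbij := IsAlgClosed.algebraMap_bijective_of_isIntegral (k := ℂ) (K := A₁ ⧸ Q)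
  let ε : (A₁ ⧸ Q) ≃ₐ[ℂ] ℂ := (AlgEquiv.ofBijective (Algebra.ofId ℂ (A₁ ⧸ Q)) hbij).symm
  refine ⟨ε.toAlgHom.comp (Ideal.Quotient.mkₐ ℂ Q), ?_⟩
  have key : ∀ a, χ a = 0 → ε (Ideal.Quotient.mk Q (algebraMap A A₁ a)) = 0 := fun a ha ↦ by
    have : algebraMap A A₁ a ∈ Q := by
      rw [← Ideal.mem_comap, hQc]
      exact ha
    rw [Ideal.Quotient.eq_zero_iff_mem.mpr this, map_zero]
  ext a
  have h2 : χ (a - algebraMap ℂ A (χ a)) = 0 := by simp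
  have h3 := key _ h2
  rw [map_sub, map_sub, map_sub, sub_eq_zero] at h3
  change ε (Ideal.Quotient.mk Q (algebraMap A A₁ a)) = χ a
  rw [h3, ← IsScalarTower.algebraMap_apply]
  change ε (algebraMap A₁ (A₁ ⧸ Q) (algebraMap ℂ A₁ (χ a))) = χ a
  rw [← IsScalarTower.algebraMap_apply, AlgEquiv.commutes, Algebra.algebraMap_self_apply]

/-- Outside the conductor a finite birational-type extension does not separate complex points:
two `ψ, ψ' : A₁ → ℂ` agreeing on `A` are equal unless their common restriction kills the
conductor `𝔠` (then it is a point of `A/𝔠`). [folklore] -/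
theorem algHom_eq_or_exists_of_conductor (ψ ψ' : A₁ →ₐ[ℂ] ℂ)
    (h : ψ.comp (IsScalarTower.toAlgHom ℂ A A₁) = ψ'.comp (IsScalarTower.toAlgHom ℂ A A₁)) :
    ψ = ψ' ∨ ∃ χ₂ : (A ⧸ conductorIdeal A A₁) →ₐ[ℂ] ℂ,
      χ₂.comp (IsScalarTower.toAlgHom ℂ A (A ⧸ conductorIdeal A A₁)) =
        ψ.comp (IsScalarTower.toAlgHom ℂ A A₁) := by
  by_cases hc : ∀ c ∈ conductorIdeal A A₁, ψ (algebraMap A A₁ c) = 0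
  · refine Or.inr ⟨Ideal.Quotient.liftₐ (conductorIdeal A A₁) (ψ.comp (IsScalarTower.toAlgHom ℂ A A₁))
      (fun c hcc ↦ hc c hcc), ?_⟩
    ext a
    rfl
  · left
    push Not at hc
    obtain ⟨c, hcc, hc0⟩ := hc
    have hA : ∀ a, ψ (algebraMap A A₁ a) = ψ' (algebraMap A A₁ a) := fun a ↦
      congrArg (fun f : A →ₐ[ℂ] ℂ ↦ f a) h
    ext y
    obtain ⟨b, hb⟩ := exists_eq_mul_of_mem_conductorIdeal hcc y
    have e1 := hA b
    rw [hb, map_mul, map_mul, ← hA c] at e1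
    exact mul_left_cancel₀ hc0 e1

/-- The corner of the square `(A, A₁, A/J, A₁/JA₁)` has enough complex points: a point of `A₁`
and a point of `A/J` agreeing on `A` come from a point of `A₁/JA₁`. [folklore] -/
theorem exists_algHom_quotient_map (J : Ideal A)
    [IsScalarTower ℂ (A ⧸ J) (A₁ ⧸ J.map (algebraMap A A₁))] (ψ₁ : A₁ →ₐ[ℂ] ℂ)
    (ψ₂ : (A ⧸ J) →ₐ[ℂ] ℂ)
    (h : ψ₁.comp (IsScalarTower.toAlgHom ℂ A A₁) = ψ₂.comp (IsScalarTower.toAlgHom ℂ A (A ⧸ J))) :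
    ∃ ψ' : (A₁ ⧸ J.map (algebraMap A A₁)) →ₐ[ℂ] ℂ,
      ψ'.comp (IsScalarTower.toAlgHom ℂ A₁ (A₁ ⧸ J.map (algebraMap A A₁))) = ψ₁ ∧
        ψ'.comp (IsScalarTower.toAlgHom ℂ (A ⧸ J) (A₁ ⧸ J.map (algebraMap A A₁))) = ψ₂ := by
  have hA : ∀ a, ψ₁ (algebraMap A A₁ a) = ψ₂ (Ideal.Quotient.mk J a) := fun a ↦
    congrArg (fun f : A →ₐ[ℂ] ℂ ↦ f a) h
  have hJ : ∀ x ∈ J.map (algebraMap A A₁), ψ₁ x = 0 := by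
    intro x hx
    rw [← RingHom.mem_ker]
    revert x
    change J.map (algebraMap A A₁) ≤ RingHom.ker ψ₁
    rw [Ideal.map_le_iff_le_comap]
    intro j hj
    rw [Ideal.mem_comap, RingHom.mem_ker]
    change ψ₁ (algebraMap A A₁ j) = 0
    rw [hA, Ideal.Quotient.eq_zero_iff_mem.mpr hj, map_zero]
  refine ⟨Ideal.Quotient.liftₐ _ ψ₁ hJ, ?_, ?_⟩
  · ext x
    rfl
  · refine Ideal.Quotient.algHom_ext ℂ (AlgHom.ext fun a ↦ ?_)
    change Ideal.Quotient.liftₐ _ ψ₁ hJ (algebraMap (A ⧸ J) (A₁ ⧸ J.map (algebraMap A A₁))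
      (Ideal.Quotient.mk J a)) = ψ₂ (Ideal.Quotient.mk J a)
    rw [← hA]
    rfl

/-- If `J₁ J₂ = 0`, every complex point of `A` is a point of `A/J₁` or of `A/J₂`. [folklore] -/
theorem exists_algHom_quotient_or (J₁ J₂ : Ideal A) (hJ : J₁ * J₂ = ⊥) (χ : A →ₐ[ℂ] ℂ) :
    (∃ χ₁ : (A ⧸ J₁) →ₐ[ℂ] ℂ, χ₁.comp (IsScalarTower.toAlgHom ℂ A (A ⧸ J₁)) = χ) ∨
      ∃ χ₂ : (A ⧸ J₂) →ₐ[ℂ] ℂ, χ₂.comp (IsScalarTower.toAlgHom ℂ A (A ⧸ J₂)) = χ := by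
  have hχs : Function.Surjective χ.toRingHom := fun c ↦ ⟨algebraMap ℂ A c, χ.commutes c⟩
  have hprime : (RingHom.ker χ.toRingHom).IsPrime :=
    (RingHom.ker_isMaximal_of_surjective _ hχs).isPrime
  have hle : J₁ * J₂ ≤ RingHom.ker χ.toRingHom := by
    rw [hJ]
    exact bot_le
  rcases hprime.mul_le.mp hle with h | h
  · refine Or.inl ⟨Ideal.Quotient.liftₐ J₁ χ fun j hj ↦ h hj, ?_⟩
    ext a
    rfl
  · refine Or.inr ⟨Ideal.Quotient.liftₐ J₂ χ fun j hj ↦ h hj, ?_⟩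
    ext a
    rfl

end Points

/-! ### The two Milnor squares -/

section TwoIdeals

variable {A : Type} [CommRing A] [Algebra ℂ A] [Algebra.FiniteType ℂ A]

/-- **`A = A/J₁ ×_{A/(J₁+J₂)} A/J₂` for `J₁ ∩ J₂ = 0`**: Riemann existence in ring form for
`A/J₁` and `A/J₂` implies it for `A` (`ringRiemannExistence_of_milnorSquare` for the Milnor
square `IsMilnorSquare.of_surjective`). [cite: SGA1, Exp. XII Thm. 5.1 (proof, part 2 a));
Milnor1972, §2] -/
theorem ringRiemannExistence_of_inf_eq_bot (J₁ J₂ : Ideal A) (hJ : J₁ ⊓ J₂ = ⊥)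
    (h₁ : ∀ (T : Type) [TopologicalSpace T] (q : T → Motives.ComplexPoints (specOver ℂ (A ⧸ J₁))),
      IsCoveringMap q → (∀ x, (q ⁻¹' {x}).Finite) →
      ∃ (B : Type) (_ : CommRing B) (_ : Algebra (A ⧸ J₁) B) (_ : Algebra ℂ B) (_ : IsScalarTower ℂ (A ⧸ J₁) B)
        (_ : Module.Finite (A ⧸ J₁) B) (_ : Algebra.Etale (A ⧸ J₁) B)
        (Φ : Motives.ComplexPoints (specOver ℂ B) ≃ₜ T),
        ∀ z, q (Φ z) = AlgPoints.map (specOverOfAlgHom (IsScalarTower.toAlgHom ℂ (A ⧸ J₁) B)) z)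
    (h₂ : ∀ (T : Type) [TopologicalSpace T] (q : T → Motives.ComplexPoints (specOver ℂ (A ⧸ J₂))),
      IsCoveringMap q → (∀ x, (q ⁻¹' {x}).Finite) →
      ∃ (B : Type) (_ : CommRing B) (_ : Algebra (A ⧸ J₂) B) (_ : Algebra ℂ B) (_ : IsScalarTower ℂ (A ⧸ J₂) B)
        (_ : Module.Finite (A ⧸ J₂) B) (_ : Algebra.Etale (A ⧸ J₂) B)
        (Φ : Motives.ComplexPoints (specOver ℂ B) ≃ₜ T),
        ∀ z, q (Φ z) = AlgPoints.map (specOverOfAlgHom (IsScalarTower.toAlgHom ℂ (A ⧸ J₂) B)) z) :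
    ∀ (T : Type) [TopologicalSpace T] (q : T → Motives.ComplexPoints (specOver ℂ A)),
      IsCoveringMap q → (∀ x, (q ⁻¹' {x}).Finite) →
      ∃ (B : Type) (_ : CommRing B) (_ : Algebra A B) (_ : Algebra ℂ B) (_ : IsScalarTower ℂ A B)
        (_ : Module.Finite A B) (_ : Algebra.Etale A B)
        (Φ : Motives.ComplexPoints (specOver ℂ B) ≃ₜ T),
        ∀ z, q (Φ z) = AlgPoints.map (specOverOfAlgHom (IsScalarTower.toAlgHom ℂ A B)) z := by
  haveI : IsScalarTower ℂ (A ⧸ J₂) ((A ⧸ J₁) ⧸ J₂.map (algebraMap A (A ⧸ J₁))) :=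
    IsScalarTower.of_algebraMap_eq fun c ↦ by
      change _ = Ideal.Quotient.mk _ (algebraMap A (A ⧸ J₁) (algebraMap ℂ A c))
      rw [← IsScalarTower.algebraMap_apply ℂ A (A ⧸ J₁)]
      rfl
  haveI : Module.Finite A (A ⧸ J₁) :=
    Module.Finite.of_surjective (Ideal.Quotient.mkₐ A J₁).toLinearMap Ideal.Quotient.mk_surjective
  haveI : Module.Finite A (A ⧸ J₂) :=
    Module.Finite.of_surjective (Ideal.Quotient.mkₐ A J₂).toLinearMap Ideal.Quotient.mk_surjective
  have H : IsMilnorSquare A (A ⧸ J₁) (A ⧸ J₂) ((A ⧸ J₁) ⧸ J₂.map (algebraMap A (A ⧸ J₁))) :=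
    IsMilnorSquare.of_surjective J₂ Ideal.Quotient.mk_surjective fun a h₁ h₂ ↦ by
      rw [Ideal.Quotient.algebraMap_eq, Ideal.Quotient.eq_zero_iff_mem] at h₁
      have : a ∈ J₁ ⊓ J₂ := ⟨h₁, h₂⟩
      rwa [hJ, Ideal.mem_bot] at this
  refine ringRiemannExistence_of_milnorSquare H ?_ ?_ ?_ ?_ h₁ h₂
  · exact exists_algHom_quotient_or J₁ J₂ (le_bot_iff.mp (hJ ▸ Ideal.mul_le_inf)) 
  · intro ψ ψ' h
    exact Ideal.Quotient.algHom_ext ℂ h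
  · intro ψ ψ' h
    exact Or.inl (Ideal.Quotient.algHom_ext ℂ h)
  · exact exists_algHom_quotient_map J₂

end TwoIdeals

section Conductor

variable (A : Type) [CommRing A] [IsDomain A] [Algebra ℂ A] [Algebra.FiniteType ℂ A]

/-- The normalisation of a finitely generated domain over `ℂ` is a finite module
(E. Noether; the tree's `NoetherFiniteIntegralClosure_holds`). [cite: Liu2002, Cor. 4.1.30] -/
theorem finite_integralClosure_fractionRing :
    Module.Finite A (integralClosure A (FractionRing A)) :=
  Resolution.NoetherFiniteIntegralClosure_holds.self ℂ A (FractionRing A)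

/-- The conductor of a finitely generated domain over `ℂ` in its normalisation is non-zero (a
common denominator of module generators lies in it). [folklore] -/
theorem conductorIdeal_integralClosure_ne_bot :
    conductorIdeal A (integralClosure A (FractionRing A)) ≠ ⊥ := by
  classical
  haveI := finite_integralClosure_fractionRing A
  obtain ⟨s, hs⟩ := Module.finite_def.mp ‹Module.Finite A (integralClosure A (FractionRing A))›
  obtain ⟨⟨d, hd⟩, hd'⟩ := IsLocalization.exist_integer_multiples_of_finset (nonZeroDivisors A)
    (s.image (Subtype.val : integralClosure A (FractionRing A) → FractionRing A))
  have hdc : d ∈ conductorIdeal A (integralClosure A (FractionRing A)) := by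
    refine mem_conductorIdeal_of_span (fun x : s ↦ (x : integralClosure A (FractionRing A)))
      (by rw [← hs]; congr 1; ext x; simp) d fun x ↦ ?_
    obtain ⟨b, hb⟩ := hd' x.1.1 (Finset.mem_image_of_mem _ x.2)
    refine ⟨b, Subtype.ext ?_⟩
    change algebraMap A (FractionRing A) b = algebraMap A (FractionRing A) d * (x : FractionRing A)
    rw [hb, Algebra.smul_def]
  intro h
  rw [h, Ideal.mem_bot] at hdc
  exact nonZeroDivisors.ne_zero hd hdc

/-- **The conductor square**: for a finitely generated domain `A` over `ℂ` with normalisation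
`Ã` and conductor `𝔠`, Riemann existence in ring form for the normal rings (hypothesis) and for
`A/𝔠` implies it for `A` (`ringRiemannExistence_of_milnorSquare` for the Milnor square
`IsMilnorSquare.conductor`; complex points of `A` extend to `Ã` by lying over, and `Ã → A` is
injective on complex points outside `V(𝔠)`).
[cite: SGA1, Exp. XII Thm. 5.1 (proof, part 2 a)); Milnor1972, §2] -/
theorem ringRiemannExistence_of_isDomain
    (hnormal : ∀ (R : Type) [CommRing R] [IsDomain R] [IsIntegrallyClosed R] [Algebra ℂ R]
      [Algebra.FiniteType ℂ R], ∀ (T : Type) [TopologicalSpace T] (q : T → Motives.ComplexPoints (specOver ℂ R)),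
        IsCoveringMap q → (∀ x, (q ⁻¹' {x}).Finite) →
        ∃ (B : Type) (_ : CommRing B) (_ : Algebra R B) (_ : Algebra ℂ B) (_ : IsScalarTower ℂ R B)
          (_ : Module.Finite R B) (_ : Algebra.Etale R B)
          (Φ : Motives.ComplexPoints (specOver ℂ B) ≃ₜ T),
          ∀ z, q (Φ z) = AlgPoints.map (specOverOfAlgHom (IsScalarTower.toAlgHom ℂ R B)) z)
    (h𝔠 : ∀ (T : Type) [TopologicalSpace T] (q : T → Motives.ComplexPoints (specOver ℂ (A ⧸ conductorIdeal A (integralClosure A (FractionRing A))))),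
      IsCoveringMap q → (∀ x, (q ⁻¹' {x}).Finite) →
      ∃ (B : Type) (_ : CommRing B) (_ : Algebra (A ⧸ conductorIdeal A (integralClosure A (FractionRing A))) B) (_ : Algebra ℂ B) (_ : IsScalarTower ℂ (A ⧸ conductorIdeal A (integralClosure A (FractionRing A))) B)
        (_ : Module.Finite (A ⧸ conductorIdeal A (integralClosure A (FractionRing A))) B) (_ : Algebra.Etale (A ⧸ conductorIdeal A (integralClosure A (FractionRing A))) B)
        (Φ : Motives.ComplexPoints (specOver ℂ B) ≃ₜ T),
        ∀ z, q (Φ z) = AlgPoints.map (specOverOfAlgHom (IsScalarTower.toAlgHom ℂ (A ⧸ conductorIdeal A (integralClosure A (FractionRing A))) B)) z) :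
    ∀ (T : Type) [TopologicalSpace T] (q : T → Motives.ComplexPoints (specOver ℂ A)),
      IsCoveringMap q → (∀ x, (q ⁻¹' {x}).Finite) →
      ∃ (B : Type) (_ : CommRing B) (_ : Algebra A B) (_ : Algebra ℂ B) (_ : IsScalarTower ℂ A B)
        (_ : Module.Finite A B) (_ : Algebra.Etale A B)
        (Φ : Motives.ComplexPoints (specOver ℂ B) ≃ₜ T),
        ∀ z, q (Φ z) = AlgPoints.map (specOverOfAlgHom (IsScalarTower.toAlgHom ℂ A B)) z := by
  haveI := finite_integralClosure_fractionRing A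
  haveI : IsIntegrallyClosed (integralClosure A (FractionRing A)) :=
    integralClosure.isIntegrallyClosedOfFiniteExtension (R := A) (FractionRing A)
      (L := FractionRing A)
  haveI : Algebra.FiniteType ℂ (integralClosure A (FractionRing A)) :=
    Algebra.FiniteType.trans (S := A) inferInstance inferInstance
  have hinj : Function.Injective (algebraMap A (integralClosure A (FractionRing A))) :=
    fun a b h ↦ IsFractionRing.injective A (FractionRing A) (congrArg Subtype.val h)
  haveI : IsScalarTower ℂ (A ⧸ conductorIdeal A (integralClosure A (FractionRing A)))
      ((integralClosure A (FractionRing A)) ⧸ (conductorIdeal A (integralClosure A (FractionRing A))).map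
        (algebraMap A (integralClosure A (FractionRing A)))) :=
    IsScalarTower.of_algebraMap_eq fun c ↦ by
      change _ = Ideal.Quotient.mk _ (algebraMap A (integralClosure A (FractionRing A)) (algebraMap ℂ A c))
      rw [← IsScalarTower.algebraMap_apply ℂ A]
      rfl
  haveI : Module.Finite A (A ⧸ conductorIdeal A (integralClosure A (FractionRing A))) :=
    Module.Finite.of_surjective (Ideal.Quotient.mkₐ A _).toLinearMap Ideal.Quotient.mk_surjective
  refine ringRiemannExistence_of_milnorSquare (IsMilnorSquare.conductor hinj) ?_ ?_ ?_ ?_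
    (hnormal (integralClosure A (FractionRing A))) h𝔠
  · exact fun χ ↦ Or.inl (exists_algHom_comp_eq_of_isIntegral hinj χ)
  · intro ψ ψ' h
    exact Ideal.Quotient.algHom_ext ℂ h
  · exact algHom_eq_or_exists_of_conductor
  · exact exists_algHom_quotient_map _

end Conductor

/-! ### Noetherian induction -/

section Induction

/-- In a reduced ring the annihilator of an ideal is a radical ideal. [folklore] -/
theorem isRadical_annihilator {A : Type} [CommRing A] [IsReduced A] (𝔞 : Ideal A) : (𝔞.annihilator).IsRadical := by
  intro x hx
  obtain ⟨n, hn⟩ := hx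
  rw [Submodule.mem_annihilator] at hn ⊢
  intro a ha
  have key : x ^ n * a = 0 := hn a ha
  have h1 : IsNilpotent (x • a) := ⟨n + 1, by
    rw [smul_eq_mul, mul_pow]
    calc x ^ (n + 1) * a ^ (n + 1) = x * (x ^ n * a) * a ^ n := by ring
      _ = 0 := by rw [key, mul_zero, zero_mul]⟩
  exact h1.eq_zero

variable {R : Type} [CommRing R] [Algebra ℂ R]

/-- Transport of Riemann existence (ring form) along the third isomorphism theorem
`R/K ≅ (R/I)/J`, `K` the preimage of `J`. [folklore] -/
theorem ringRiemannExistence_doubleQuot (I : Ideal R) (J : Ideal (R ⧸ I))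
    (h : ∀ (T : Type) [TopologicalSpace T] (q : T → Motives.ComplexPoints (specOver ℂ (R ⧸ J.comap (Ideal.Quotient.mkₐ ℂ I)))),
      IsCoveringMap q → (∀ x, (q ⁻¹' {x}).Finite) →
      ∃ (B : Type) (_ : CommRing B) (_ : Algebra (R ⧸ J.comap (Ideal.Quotient.mkₐ ℂ I)) B) (_ : Algebra ℂ B) (_ : IsScalarTower ℂ (R ⧸ J.comap (Ideal.Quotient.mkₐ ℂ I)) B)
        (_ : Module.Finite (R ⧸ J.comap (Ideal.Quotient.mkₐ ℂ I)) B) (_ : Algebra.Etale (R ⧸ J.comap (Ideal.Quotient.mkₐ ℂ I)) B)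
        (Φ : Motives.ComplexPoints (specOver ℂ B) ≃ₜ T),
        ∀ z, q (Φ z) = AlgPoints.map (specOverOfAlgHom (IsScalarTower.toAlgHom ℂ (R ⧸ J.comap (Ideal.Quotient.mkₐ ℂ I)) B)) z) :
    ∀ (T : Type) [TopologicalSpace T] (q : T → Motives.ComplexPoints (specOver ℂ ((R ⧸ I) ⧸ J))),
      IsCoveringMap q → (∀ x, (q ⁻¹' {x}).Finite) →
      ∃ (B : Type) (_ : CommRing B) (_ : Algebra ((R ⧸ I) ⧸ J) B) (_ : Algebra ℂ B) (_ : IsScalarTower ℂ ((R ⧸ I) ⧸ J) B)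
        (_ : Module.Finite ((R ⧸ I) ⧸ J) B) (_ : Algebra.Etale ((R ⧸ I) ⧸ J) B)
        (Φ : Motives.ComplexPoints (specOver ℂ B) ≃ₜ T),
        ∀ z, q (Φ z) = AlgPoints.map (specOverOfAlgHom (IsScalarTower.toAlgHom ℂ ((R ⧸ I) ⧸ J) B)) z := by
  have hle : I ≤ J.comap (Ideal.Quotient.mkₐ ℂ I) := fun x hx ↦ by
    rw [Ideal.mem_comap, Ideal.Quotient.mkₐ_eq_mk, Ideal.Quotient.eq_zero_iff_mem.mpr hx]
    exact J.zero_mem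
  have hmap : (J.comap (Ideal.Quotient.mkₐ ℂ I)).map (Ideal.Quotient.mkₐ ℂ I) = J :=
    Ideal.map_comap_of_surjective _ Ideal.Quotient.mk_surjective J
  let e : ((R ⧸ I) ⧸ J) ≃ₐ[ℂ] R ⧸ J.comap (Ideal.Quotient.mkₐ ℂ I) :=
    (Ideal.quotientEquivAlgOfEq ℂ hmap.symm).trans (DoubleQuot.quotQuotEquivQuotOfLEₐ ℂ hle)
  exact ringRiemannExistence_of_algEquiv e.symm h

/-- **Riemann existence in ring form for all reduced quotients of a finite type `ℂ`-algebra
follows from the ∀ (R : Type) [CommRing R] [IsDomain R] [IsIntegrallyClosed R] [Algebra ℂ R]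
      [Algebra.FiniteType ℂ R], ∀ (T : Type) [TopologicalSpace T] (q : T → Motives.ComplexPoints (specOver ℂ R)),
        IsCoveringMap q → (∀ x, (q ⁻¹' {x}).Finite) →
        ∃ (B : Type) (_ : CommRing B) (_ : Algebra R B) (_ : Algebra ℂ B) (_ : IsScalarTower ℂ R B)
          (_ : Module.Finite R B) (_ : Algebra.Etale R B)
          (Φ : Motives.ComplexPoints (specOver ℂ B) ≃ₜ T),
          ∀ z, q (Φ z) = AlgPoints.map (specOverOfAlgHom (IsScalarTower.toAlgHom ℂ R B)) z case** (Noetherian induction on the radical ideal `I`): the zero ring is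
trivial; if `R/I` is a domain, use the conductor square of its (finite) normalisation
(`ringRiemannExistence_of_isDomain`), the factor `(R/I)/𝔠` being reached from the radical ideal
`√𝔠 ⊋ 0` (induction) through the nilpotent thickening `(R/I)/𝔠 → (R/I)/√𝔠`
(`ringRiemannExistence_of_surjective_of_isNilpotent`); otherwise `R/I` has non-zero `a b = 0` and
is the Milnor square of `J₁ = Ann(b) ∋ a` and `J₂ = Ann(J₁) ∋ b`, two non-zero radical ideals with
`J₁ ∩ J₂ = 0` (`ringRiemannExistence_of_inf_eq_bot`). This replaces the descent along the
normalisation (SGA 1 IX 4.7) in part 2 a) of the proof of SGA 1 XII 5.1.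
[cite: SGA1, Exp. XII Thm. 5.1 (proof, part 2 a))] -/
theorem ringRiemannExistence_quotient_of_isRadical [Algebra.FiniteType ℂ R]
    (hnormal : ∀ (R : Type) [CommRing R] [IsDomain R] [IsIntegrallyClosed R] [Algebra ℂ R]
      [Algebra.FiniteType ℂ R], ∀ (T : Type) [TopologicalSpace T] (q : T → Motives.ComplexPoints (specOver ℂ R)),
        IsCoveringMap q → (∀ x, (q ⁻¹' {x}).Finite) →
        ∃ (B : Type) (_ : CommRing B) (_ : Algebra R B) (_ : Algebra ℂ B) (_ : IsScalarTower ℂ R B)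
          (_ : Module.Finite R B) (_ : Algebra.Etale R B)
          (Φ : Motives.ComplexPoints (specOver ℂ B) ≃ₜ T),
          ∀ z, q (Φ z) = AlgPoints.map (specOverOfAlgHom (IsScalarTower.toAlgHom ℂ R B)) z)
    (I : Ideal R) (hI : I.IsRadical) :
    ∀ (T : Type) [TopologicalSpace T] (q : T → Motives.ComplexPoints (specOver ℂ (R ⧸ I))),
      IsCoveringMap q → (∀ x, (q ⁻¹' {x}).Finite) →
      ∃ (B : Type) (_ : CommRing B) (_ : Algebra (R ⧸ I) B) (_ : Algebra ℂ B) (_ : IsScalarTower ℂ (R ⧸ I) B)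
        (_ : Module.Finite (R ⧸ I) B) (_ : Algebra.Etale (R ⧸ I) B)
        (Φ : Motives.ComplexPoints (specOver ℂ B) ≃ₜ T),
        ∀ z, q (Φ z) = AlgPoints.map (specOverOfAlgHom (IsScalarTower.toAlgHom ℂ (R ⧸ I) B)) z := by
  haveI : IsNoetherianRing R := Algebra.FiniteType.isNoetherianRing ℂ R
  revert hI
  refine (wellFounded_gt (α := Ideal R)).induction
    (C := fun I : Ideal R ↦ I.IsRadical → ∀ (T : Type) [TopologicalSpace T] (q : T → Motives.ComplexPoints (specOver ℂ (R ⧸ I))),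
        IsCoveringMap q → (∀ x, (q ⁻¹' {x}).Finite) →
        ∃ (B : Type) (_ : CommRing B) (_ : Algebra (R ⧸ I) B) (_ : Algebra ℂ B) (_ : IsScalarTower ℂ (R ⧸ I) B)
          (_ : Module.Finite (R ⧸ I) B) (_ : Algebra.Etale (R ⧸ I) B)
          (Φ : Motives.ComplexPoints (specOver ℂ B) ≃ₜ T),
          ∀ z, q (Φ z) = AlgPoints.map (specOverOfAlgHom (IsScalarTower.toAlgHom ℂ (R ⧸ I) B)) z) I (fun I ih ↦ ?_)
  intro hI
  haveI : IsReduced (R ⧸ I) := (Ideal.isRadical_iff_quotient_reduced I).mp hI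
  -- the induction hypothesis for a non-zero radical ideal `J` of `R ⧸ I`
  have use : ∀ J : Ideal (R ⧸ I), J ≠ ⊥ → J.IsRadical → ∀ (T : Type) [TopologicalSpace T] (q : T → Motives.ComplexPoints (specOver ℂ ((R ⧸ I) ⧸ J))),
        IsCoveringMap q → (∀ x, (q ⁻¹' {x}).Finite) →
        ∃ (B : Type) (_ : CommRing B) (_ : Algebra ((R ⧸ I) ⧸ J) B) (_ : Algebra ℂ B) (_ : IsScalarTower ℂ ((R ⧸ I) ⧸ J) B)
          (_ : Module.Finite ((R ⧸ I) ⧸ J) B) (_ : Algebra.Etale ((R ⧸ I) ⧸ J) B)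
          (Φ : Motives.ComplexPoints (specOver ℂ B) ≃ₜ T),
          ∀ z, q (Φ z) = AlgPoints.map (specOverOfAlgHom (IsScalarTower.toAlgHom ℂ ((R ⧸ I) ⧸ J) B)) z := by
    intro J hJ hJr
    refine ringRiemannExistence_doubleQuot I J (ih _ ?_ (hJr.comap _))
    refine lt_of_le_of_ne (fun x hx ↦ ?_) (fun heq ↦ hJ ?_)
    · rw [Ideal.mem_comap, Ideal.Quotient.mkₐ_eq_mk, Ideal.Quotient.eq_zero_iff_mem.mpr hx]
      exact J.zero_mem
    · rw [← Ideal.map_comap_of_surjective (Ideal.Quotient.mkₐ ℂ I) Ideal.Quotient.mk_surjective J,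
        ← heq]
      exact le_bot_iff.mp (Ideal.map_le_iff_le_comap.mpr fun x hx ↦ by
        rw [Ideal.mem_comap, Ideal.Quotient.mkₐ_eq_mk, Ideal.Quotient.eq_zero_iff_mem.mpr hx]
        exact Ideal.zero_mem _)
  by_cases h0 : Subsingleton (R ⧸ I)
  · exact ringRiemannExistence_of_subsingleton _
  by_cases hdom : IsDomain (R ⧸ I)
  · -- the conductor square of the normalisation of the domain `R ⧸ I`
    haveI := hdom
    have h𝔠ne := conductorIdeal_integralClosure_ne_bot (R ⧸ I)
    have hrad := use (conductorIdeal (R ⧸ I) (integralClosure (R ⧸ I) (FractionRing (R ⧸ I)))).radical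
      (fun h ↦ h𝔠ne (le_bot_iff.mp (h ▸ Ideal.le_radical))) (Ideal.radical_isRadical _)
    refine ringRiemannExistence_of_isDomain (R ⧸ I) hnormal
      (ringRiemannExistence_of_surjective_of_isNilpotent
        (Ideal.Quotient.factorₐ ℂ Ideal.le_radical) (fun x ↦ ?_) ?_ hrad)
    · obtain ⟨a, rfl⟩ := Ideal.Quotient.mk_surjective x
      exact ⟨Ideal.Quotient.mk _ a, rfl⟩
    · obtain ⟨n, hn⟩ := IsNoetherianRing.isNilpotent_nilradical
        ((R ⧸ I) ⧸ conductorIdeal (R ⧸ I) (integralClosure (R ⧸ I) (FractionRing (R ⧸ I))))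
      refine ⟨n, ?_⟩
      rw [Ideal.zero_eq_bot, ← le_bot_iff, ← Ideal.zero_eq_bot, ← hn]
      refine Ideal.pow_right_mono (fun x hx ↦ ?_) n
      obtain ⟨a, rfl⟩ := Ideal.Quotient.mk_surjective x
      have hx' : Ideal.Quotient.mk _ a = 0 := hx
      obtain ⟨m, hm⟩ := Ideal.Quotient.eq_zero_iff_mem.mp hx'
      refine mem_nilradical.mpr ⟨m, ?_⟩
      rw [← map_pow, Ideal.Quotient.eq_zero_iff_mem]
      exact hm
  · -- a reduced non-domain: two non-zero radical ideals with zero intersection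
    haveI : Nontrivial (R ⧸ I) := not_subsingleton_iff_nontrivial.mp h0
    obtain ⟨a, b, ha, hb, hab⟩ : ∃ a b : R ⧸ I, a ≠ 0 ∧ b ≠ 0 ∧ a * b = 0 := by
      by_contra hne
      push Not at hne
      refine hdom (@NoZeroDivisors.to_isDomain _ _ _ ⟨fun {x y} h ↦ ?_⟩)
      by_contra h'
      push Not at h'
      exact hne x y h'.1 h'.2 h
    let J₁ : Ideal (R ⧸ I) := (Ideal.span {b}).annihilator
    let J₂ : Ideal (R ⧸ I) := J₁.annihilator
    have ha₁ : a ∈ J₁ := (Submodule.mem_annihilator_span_singleton b a).mpr (by rw [smul_eq_mul, hab])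
    have hb₂ : b ∈ J₂ := Submodule.mem_annihilator.mpr fun x hx ↦ by
      have := (Submodule.mem_annihilator_span_singleton b x).mp hx
      rw [smul_eq_mul] at this ⊢
      rw [mul_comm, this]
    have hJ : J₁ ⊓ J₂ = ⊥ := le_bot_iff.mp fun x hx ↦ by
      have : x * x = 0 := Submodule.mem_annihilator.mp hx.2 x hx.1
      exact (Ideal.mem_bot).mpr (IsNilpotent.eq_zero ⟨2, by rw [pow_two, this]⟩)
    refine ringRiemannExistence_of_inf_eq_bot J₁ J₂ hJ (use J₁ ?_ (isRadical_annihilator _))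
      (use J₂ ?_ (isRadical_annihilator _))
    · intro h
      rw [h, Ideal.mem_bot] at ha₁
      exact ha ha₁
    · intro h
      rw [h, Ideal.mem_bot] at hb₂
      exact hb hb₂

variable (R) in
/-- **Riemann existence in ring form for a reduced finite type `ℂ`-algebra follows from the
normal case.** [cite: SGA1, Exp. XII Thm. 5.1 (proof, part 2 a))] -/
theorem ringRiemannExistence_of_isReduced [Algebra.FiniteType ℂ R] [IsReduced R]
    (hnormal : ∀ (R : Type) [CommRing R] [IsDomain R] [IsIntegrallyClosed R] [Algebra ℂ R]
      [Algebra.FiniteType ℂ R], ∀ (T : Type) [TopologicalSpace T] (q : T → Motives.ComplexPoints (specOver ℂ R)),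
        IsCoveringMap q → (∀ x, (q ⁻¹' {x}).Finite) →
        ∃ (B : Type) (_ : CommRing B) (_ : Algebra R B) (_ : Algebra ℂ B) (_ : IsScalarTower ℂ R B)
          (_ : Module.Finite R B) (_ : Algebra.Etale R B)
          (Φ : Motives.ComplexPoints (specOver ℂ B) ≃ₜ T),
          ∀ z, q (Φ z) = AlgPoints.map (specOverOfAlgHom (IsScalarTower.toAlgHom ℂ R B)) z) :
    ∀ (T : Type) [TopologicalSpace T] (q : T → Motives.ComplexPoints (specOver ℂ R)),
      IsCoveringMap q → (∀ x, (q ⁻¹' {x}).Finite) →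
      ∃ (B : Type) (_ : CommRing B) (_ : Algebra R B) (_ : Algebra ℂ B) (_ : IsScalarTower ℂ R B)
        (_ : Module.Finite R B) (_ : Algebra.Etale R B)
        (Φ : Motives.ComplexPoints (specOver ℂ B) ≃ₜ T),
        ∀ z, q (Φ z) = AlgPoints.map (specOverOfAlgHom (IsScalarTower.toAlgHom ℂ R B)) z :=
  ringRiemannExistence_of_algEquiv (AlgEquiv.quotientBot ℂ R)
    (ringRiemannExistence_quotient_of_isRadical hnormal ⊥ fun _ ⟨n, hn⟩ ↦
      Ideal.mem_bot.mpr (IsNilpotent.eq_zero ⟨n, Ideal.mem_bot.mp hn⟩))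

end Induction

/-! ### Assembly: the named fact from the normal affine case -/

section Assembly

/-- **Riemann's existence theorem in covering form (the named fact
`riemannExistence_finiteCovering`, SGA 1 XII 5.1) follows from its case of ∀ (R : Type) [CommRing R] [IsDomain R] [IsIntegrallyClosed R] [Algebra ℂ R]
      [Algebra.FiniteType ℂ R], ∀ (T : Type) [TopologicalSpace T] (q : T → Motives.ComplexPoints (specOver ℂ R)),
        IsCoveringMap q → (∀ x, (q ⁻¹' {x}).Finite) →
        ∃ (B : Type) (_ : CommRing B) (_ : Algebra R B) (_ : Algebra ℂ B) (_ : IsScalarTower ℂ R B)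
          (_ : Module.Finite R B) (_ : Algebra.Etale R B)
          (Φ : Motives.ComplexPoints (specOver ℂ B) ≃ₜ T),
          ∀ z, q (Φ z) = AlgPoints.map (specOverOfAlgHom (IsScalarTower.toAlgHom ℂ R B)) z AFFINE varieties,
in ring form**: every finite-fibred covering space of `(Spec R)(ℂ)`, `R` an integrally closed
domain of finite type over `ℂ`, is `(Spec B)(ℂ)` for a finite étale `R`-algebra `B`. Reductions:
quasi-projective ⇒ reduced (`riemannExistence_finiteCovering_of_reduced`, `S_red ↪ S`) ⇒ affine
opens (`ZariskiLocal.riemannExistence_of_affineOpens`) ⇒ ring form (`Γ(U) `reduced of finite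
type; `riemannExistence_of_iso`, `riemannExistence_specOver_of_ring`) ⇒ normal
(`ringRiemannExistence_of_isReduced`: Noetherian induction over conductor / two-component Milnor
squares, in place of SGA 1 IX 4.7). What remains is the analytic core of loc. cit. for normal `X`
(XII 5.3 Hartogs-type extension, resolution, XII 5.4 via GAGA).
[cite: SGA1, Exp. XII Thm. 5.1 (proof, part 2 a) «on peut donc supposer X normal»)] -/
theorem riemannExistence_finiteCovering_of_normal
    (hnormal : ∀ (R : Type) [CommRing R] [IsDomain R] [IsIntegrallyClosed R] [Algebra ℂ R]
      [Algebra.FiniteType ℂ R], ∀ (T : Type) [TopologicalSpace T] (q : T → Motives.ComplexPoints (specOver ℂ R)),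
        IsCoveringMap q → (∀ x, (q ⁻¹' {x}).Finite) →
        ∃ (B : Type) (_ : CommRing B) (_ : Algebra R B) (_ : Algebra ℂ B) (_ : IsScalarTower ℂ R B)
          (_ : Module.Finite R B) (_ : Algebra.Etale R B)
          (Φ : Motives.ComplexPoints (specOver ℂ B) ≃ₜ T),
          ∀ z, q (Φ z) = AlgPoints.map (specOverOfAlgHom (IsScalarTower.toAlgHom ℂ R B)) z) :
    riemannExistence_finiteCovering := by
  refine riemannExistence_finiteCovering_of_reduced fun S hS hred T _ q hq hfin ↦ ?_
  haveI := hred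
  obtain ⟨P, j, hP, hj⟩ := hS
  haveI := hj
  haveI : IsProper P.hom := hP.isProper
  haveI : IsSeparated S.hom := by rw [← Over.w j]; infer_instance
  haveI : LocallyOfFiniteType S.hom := by rw [← Over.w j]; infer_instance
  refine ZariskiLocal.riemannExistence_of_affineOpens (X := S) (fun U hU _ T' _ q' hq' hfin' ↦ ?_)
    q hq hfin
  haveI : IsAffine (↑U : Scheme) := hU
  -- `Γ(U)` is a reduced `ℂ`-algebra of finite type
  have hft : LocallyOfFiniteType (U.ι ≫ S.hom) := inferInstance
  rw [HasRingHomProperty.iff_of_isAffine (P := @LocallyOfFiniteType)] at hft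
  haveI : Algebra.FiniteType ℂ Γ(↑U, ⊤) := by
    rw [← RingHom.finiteType_algebraMap]
    change RingHom.FiniteType ((Scheme.ΓSpecIso (.of ℂ)).inv ≫ (U.ι ≫ S.hom).appTop).hom
    rw [CommRingCat.hom_comp]
    exact RingHom.FiniteType.comp hft (RingHom.FiniteType.of_surjective _
      (Scheme.ΓSpecIso (.of ℂ)).commRingCatIsoToRingEquiv.symm.surjective)
  exact riemannExistence_of_iso (baseOpenOverIsoSpec S U hU).symm
    (riemannExistence_specOver_of_ring _ (ringRiemannExistence_of_isReduced Γ(↑U, ⊤) hnormal))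
    T' q' hq' hfin'

end Assembly

/-! ### Scheme form of the normal hypothesis -/

section SchemeForm

variable (R : Type) [CommRing R] [Algebra ℂ R]

/-- **Scheme form ⇒ ring form** for `Spec R`: a finite étale `S' → Spec R` realising a covering is
affine, `S' ≅ Spec Γ(S')`, and `Γ(S')` is a finite étale `R`-algebra with the same complex
points. [folklore] -/
theorem ringRiemannExistence_of_specOver
    (h : ∀ (T : Type) [TopologicalSpace T] (q : T → Motives.ComplexPoints (specOver ℂ R)),
      IsCoveringMap q → (∀ x, (q ⁻¹' {x}).Finite) →
      ∃ (S' : Motives.SchemeOver ℂ) (g : S' ⟶ (specOver ℂ R)) (Φ : Motives.ComplexPoints S' ≃ₜ T),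
        IsFinite g.left ∧ Etale g.left ∧ ∀ z, q (Φ z) = AlgPoints.map g z) :
    ∀ (T : Type) [TopologicalSpace T] (q : T → Motives.ComplexPoints (specOver ℂ R)),
      IsCoveringMap q → (∀ x, (q ⁻¹' {x}).Finite) →
      ∃ (B : Type) (_ : CommRing B) (_ : Algebra R B) (_ : Algebra ℂ B) (_ : IsScalarTower ℂ R B)
        (_ : Module.Finite R B) (_ : Algebra.Etale R B)
        (Φ : Motives.ComplexPoints (specOver ℂ B) ≃ₜ T),
        ∀ z, q (Φ z) = AlgPoints.map (specOverOfAlgHom (IsScalarTower.toAlgHom ℂ R B)) z := by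
  intro T _ q hq hfin
  obtain ⟨S', g, Φ, hg₁, hg₂, hΦ⟩ := h T q hq hfin
  haveI := hg₁
  haveI := hg₂
  -- the underlying morphisms with their types spelled out as morphisms to `Spec`
  let g' : S'.left ⟶ Spec (.of R) := g.left
  let s' : S'.left ⟶ Spec (.of ℂ) := S'.hom
  have hg' : IsFinite g' := hg₁
  have hg'' : Etale g' := hg₂
  have hw : s' = g' ≫ Spec.map (CommRingCat.ofHom (algebraMap ℂ R)) := (Over.w g).symm
  haveI : IsAffine S'.left := isAffine_of_isAffineHom g'
  -- `B = Γ(S')` as an `R`-algebra and a `ℂ`-algebra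
  letI algR : Algebra R Γ(S'.left, ⊤) :=
    ((Scheme.ΓSpecIso (.of R)).inv ≫ g'.appTop).hom.toAlgebra
  letI algC : Algebra ℂ Γ(S'.left, ⊤) :=
    ((Scheme.ΓSpecIso (.of ℂ)).inv ≫ s'.appTop).hom.toAlgebra
  haveI : IsScalarTower ℂ R Γ(S'.left, ⊤) := IsScalarTower.of_algebraMap_eq fun c ↦ by
    change ((Scheme.ΓSpecIso (.of ℂ)).inv ≫ s'.appTop).hom c =
      ((Scheme.ΓSpecIso (.of R)).inv ≫ g'.appTop).hom (algebraMap ℂ R c)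
    rw [hw, Scheme.Hom.comp_appTop, ← Category.assoc, ← Scheme.ΓSpecIso_inv_naturality,
      Category.assoc]
    rfl
  have hfinQ := (HasAffineProperty.iff_of_isAffine (P := @IsFinite)).mp hg'
  haveI : Module.Finite R Γ(S'.left, ⊤) := by
    rw [← RingHom.finite_algebraMap]
    change RingHom.Finite ((Scheme.ΓSpecIso (.of R)).inv ≫ g'.appTop).hom
    rw [CommRingCat.hom_comp]
    exact hfinQ.2.comp (RingHom.Finite.of_surjective _
      (Scheme.ΓSpecIso (.of R)).commRingCatIsoToRingEquiv.symm.surjective)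
  have hetQ := (HasRingHomProperty.iff_of_isAffine (P := @Etale)).mp hg''
  haveI : Algebra.Etale R Γ(S'.left, ⊤) := by
    rw [← RingHom.etale_algebraMap]
    change RingHom.Etale ((Scheme.ΓSpecIso (.of R)).inv ≫ g'.appTop).hom
    rw [CommRingCat.hom_comp]
    exact RingHom.Etale.stableUnderComposition _ _ (RingHom.Etale.of_bijective
      (Scheme.ΓSpecIso (.of R)).commRingCatIsoToRingEquiv.symm.bijective) hetQ
  -- `S' ≅ Spec Γ(S')` over `ℂ`, compatibly with `g`
  let e : S' ≅ specOver ℂ Γ(S'.left, ⊤) := Over.isoMk S'.left.isoSpec (by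
    change S'.left.toSpecΓ ≫ Spec.map ((Scheme.ΓSpecIso (.of ℂ)).inv ≫ s'.appTop) = s'
    rw [Spec.map_comp, ← Scheme.toSpecΓ_naturality_assoc,
      AlgebraicGeometry.toSpecΓ_SpecMap_ΓSpecIso_inv, Category.comp_id])
  have he : e.hom ≫ specOverOfAlgHom (IsScalarTower.toAlgHom ℂ R Γ(S'.left, ⊤)) = g := by
    ext1
    change S'.left.toSpecΓ ≫ Spec.map (CommRingCat.ofHom
      ((Scheme.ΓSpecIso (.of R)).inv ≫ g'.appTop).hom) = g'
    rw [CommRingCat.ofHom_hom, Spec.map_comp, ← Scheme.toSpecΓ_naturality_assoc,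
      AlgebraicGeometry.toSpecΓ_SpecMap_ΓSpecIso_inv, Category.comp_id]
  refine ⟨Γ(S'.left, ⊤), inferInstance, algR, algC, inferInstance, inferInstance, inferInstance,
    (pointsHomeomorphOfIso e).symm.trans Φ, fun z ↦ ?_⟩
  obtain ⟨y, rfl⟩ := (pointsHomeomorphOfIso e).surjective z
  rw [Homeomorph.trans_apply, Homeomorph.symm_apply_apply, hΦ, pointsHomeomorphOfIso_apply,
    ← AlgPoints.map_comp_apply, he]

/-- **`riemannExistence_finiteCovering` from the NORMAL AFFINE case in scheme form**: it suffices
that every finite-fibred covering space of `S(ℂ)` be algebraic for `S` affine of finite type over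
`ℂ` with `Γ(S, 𝒪_S)` an integrally closed domain (= `S` a normal affine variety).
[cite: SGA1, Exp. XII Thm. 5.1 (proof, part 2 a) «on peut donc supposer X normal»)] -/
theorem riemannExistence_finiteCovering_of_normal_affine
    (h : ∀ (S : Motives.SchemeOver ℂ), IsAffine S.left → LocallyOfFiniteType S.hom →
      IsDomain Γ(S.left, ⊤) → IsIntegrallyClosed Γ(S.left, ⊤) →
      ∀ (T : Type) [TopologicalSpace T] (q : T → Motives.ComplexPoints S),
        IsCoveringMap q → (∀ x, (q ⁻¹' {x}).Finite) →
        ∃ (S' : Motives.SchemeOver ℂ) (g : S' ⟶ S) (Φ : Motives.ComplexPoints S' ≃ₜ T),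
          IsFinite g.left ∧ Etale g.left ∧ ∀ z, q (Φ z) = AlgPoints.map g z) :
    riemannExistence_finiteCovering := by
  refine riemannExistence_finiteCovering_of_normal fun R _ _ _ _ _ ↦ ?_
  refine ringRiemannExistence_of_specOver R (h (specOver ℂ R)
    (inferInstanceAs (IsAffine (Spec (.of R)))) (locallyOfFiniteType_specOver_hom R) ?_ ?_)
  · exact Function.Injective.isDomain (Scheme.ΓSpecIso (.of R)).commRingCatIsoToRingEquiv.toRingHom
      (Scheme.ΓSpecIso (.of R)).commRingCatIsoToRingEquiv.injective
  · exact IsIntegrallyClosed.of_equiv (Scheme.ΓSpecIso (.of R)).commRingCatIsoToRingEquiv.symm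

end SchemeForm

end Literature.AlgebraicGeometry.FundamentalGroup

end
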